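import Mathlib.Algebra.Group.End
import Mathlib.Algebra.Group.Subgroup.Map
import Mathlib.Algebra.BigOperators.Intervals
import Mathlib.Algebra.BigOperators.Fin
import Mathlib.Data.Fintype.Perm
import Mathlib.Data.Fintype.Sigma
import Mathlib.Data.Fintype.BigOperators
import Mathlib.SetTheory.Cardinal.Finite
import Mathlib.Tactic
import Literature.Combinatorics.Additive.TripleProductProperty
import HarnessLib

/-!
# The Cohn–Umans triangle construction: three Young subgroups of `S_{N(N+1)/2}` with the triple product property

Topic `Literature/Computability/AlgebraicComplexity` (group-theoretic approach to fast matrix multiplication; the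
only published construction of TPP triples of size `|G|^{1/2 - o(1)}` — Blasiak–Church–Cohn–Grochow–Umans 2017,
§4, Thm. 4.1: "there is only one currently known construction actually achieving this bound, which appeared in the
original 2003 paper of Cohn and Umans. This is the so-called triangle construction in the symmetric group").

Source: H. Cohn, C. Umans, *A group-theoretic approach to fast matrix multiplication*, FOCS 2003,
arXiv:math/0307321, §3 (held copy `paper:arxiv-math_0307321`, pp. 5–6 of the materialised text): "There are
`n(n+1)/2` triples `(a,b,c)` with `a,b,c ≥ 0` and `a+b+c = n-1`. We view `S_{n(n+1)/2}` as the group of permutations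
of these triples. Let `H_i` be the subgroup that fixes the `i`-th coordinate. The size of this subgroup is
`1!2!⋯n!` … we need to prove that if `h_1h_2h_3 = 1` with `h_i ∈ H_i`, then `h_1 = h_2 = h_3 = 1`. … We will order the
triples lexicographically … Suppose all triples smaller than `(a,b,c)` are fixed by each of `h_1, h_2, h_3` … The
permutation `h_3` cannot send `(a,b,c)` to a smaller triple … so `h_3` must send it to `(a+i,b-i,c)` with `i ≥ 0`.
Then `h_2` sends that to `(a+i+j,b-i,c-j)` for some `j`. The only way `h_1` can return to `(a,b,c)` is if `i+j=0` …
However, `h_1` fixes `(a,b-i,c+i)` for `i>0` … so we must have `i=0`."  (= BCCGU 2017, arXiv:1712.02302, Thm. 4.1.)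

## Content (all proved)

* `triangle_trivial` — the abstract induction: three `ℕ`-valued coordinates of constant sum on a finite type, any
  point determined by two of them; `h₁, h₂, h₃` preserving `a, b, c` with `h₁ h₂ h₃ = 1` are trivial.
* `coordSubgroup f` — the subgroup of `Perm P` preserving a labelling `f : P → ℕ` (for `P = Fin n` this is the
  tree's `Literature.Barriers.MatrixMultiplication.youngSubgroup`, restated here to keep this file free of the
  barrier catalogue); `tpp_coordSubgroups` — the TPP of the three coordinate subgroups as `Finset`s
  (the tree's `TripleProductProperty`, Cohn–Umans Def. 2.1); `tpp_image` — transport of the TPP along an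
  injective hom.
* `Tri N = Σ i : Fin N, Fin (N - i)` — the staircase of side `N` with coordinates `ca, cb, cc`;
  `card_coordSubgroup_ca/cb/cc` — each coordinate subgroup has order `≥ ∏_{i<N} (N-i)! = 1!2!⋯N!`
  (fibrewise permutations `Equiv.Perm.sigmaCongrRightHom`, and the coordinate swaps `(a,b) ↦ (b,a)`,
  `(a,b,c) ↦ (c,b,a)`); `two_mul_card_tri` — `2 |Tri N| = N(N+1)`.
* `CohnUmans2003_triangle_tpp` — for every `N` a TPP triple `S, T, U ⊆ S_n`, `2n = N(N+1)`, with
  `|S|, |T|, |U| ≥ ∏_{i<N} (N-i)!` (transported to `Equiv.Perm (Fin n)` along `Fintype.equivFin`).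

Not here: the size asymptotics `1!2!⋯N! = (n!)^{1/2} e^{-Θ(n)}` and the pseudo-exponent value
`2 + (2 - log 2)/log N + O(1/log² N)` (Cohn–Umans 2003, Thm. 3.3/"Theorem 6" of the arXiv text); the exact order
(equality) of the coordinate subgroups; hexagon variants (BCCGU 2017 §4).
-/

namespace Literature.Computability.AlgebraicComplexity

open Equiv

namespace CohnUmansTriangle

/-- **Abstract triangle lemma** (the induction in Cohn–Umans 2003, proof of the pseudo-exponent bound for
`S_{n(n+1)/2}`, arXiv p. 5–6: "We will order the triples lexicographically … and prove by induction using this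
ordering that `h_1`, `h_2`, and `h_3` fix every triple"). Points `P` with three coordinates `a b c : P → ℕ` of constant sum, any point being
determined by `(a, b)`. If `h₁` preserves `a`, `h₂` preserves `b`, `h₃` preserves `c` and `h₁ h₂ h₃ = 1`, then all
three are trivial (Cohn–Umans 2003, proof of Thm. 6: induction along the lexicographic order on `(a, b)`). [cite: CohnUmans2003, §3 (triangle construction)] -/
theorem triangle_trivial {P : Type*} [Fintype P] (a b c : P → ℕ)
    (hsum : ∀ p q, a p + b p + c p = a q + b q + c q)
    (hinj : ∀ p q, a p = a q → b p = b q → p = q)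
    (h₁ h₂ h₃ : Perm P) (ha : ∀ p, a (h₁ p) = a p) (hb : ∀ p, b (h₂ p) = b p)
    (hc : ∀ p, c (h₃ p) = c p) (H : ∀ p, h₁ (h₂ (h₃ p)) = p) :
    (∀ p, h₁ p = p) ∧ (∀ p, h₂ p = p) ∧ (∀ p, h₃ p = p) := by
  classical
  -- lex rank
  set K : ℕ := Finset.univ.sup b + 1 with hK
  have hbK : ∀ p, b p < K := fun p => Nat.lt_succ_of_le (Finset.le_sup (f := b) (Finset.mem_univ p))
  set rk : P → ℕ := fun p => a p * K + b p with hrk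
  have rk_lt_of_a_lt : ∀ p q, a p < a q → rk p < rk q := by
    intro p q h
    simp only [hrk]
    have := hbK p
    calc a p * K + b p < a p * K + K := by omega
      _ = (a p + 1) * K := by ring
      _ ≤ a q * K := Nat.mul_le_mul_right _ h
      _ ≤ a q * K + b q := Nat.le_add_right _ _
  have rk_lt_of_b_lt : ∀ p q, a p = a q → b p < b q → rk p < rk q := by
    intro p q h1 h2; simp only [hrk]; rw [h1]; omega
  have a_le_of_rk_le : ∀ p q, rk p ≤ rk q → a p ≤ a q := by
    intro p q h; by_contra hlt; push Not at hlt
    exact absurd h (not_le.2 (rk_lt_of_a_lt q p hlt))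
  -- main claim by strong induction on the rank
  have main : ∀ n : ℕ, ∀ p, rk p = n → h₃ p = p ∧ h₂ p = p ∧ h₁ p = p := by
    intro n
    induction n using Nat.strong_induction_on with
    | _ n ih =>
      intro p hp
      -- q := h₃ p is not of smaller rank
      set q := h₃ p with hq
      have hcq : c q = c p := hc p
      have hq_ge : rk p ≤ rk q := by
        by_contra hlt; push Not at hlt
        have hfix := (ih (rk q) (hp ▸ hlt) q rfl).1
        -- h₃ q = q and h₃ p = q ⇒ p = q
        have : p = q := h₃.injective (by rw [hfix])
        rw [this] at hlt; exact lt_irrefl _ hlt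
      have haq : a p ≤ a q := a_le_of_rk_le p q hq_ge
      have habq : a q + b q = a p + b p := by have := hsum q p; omega
      -- r := h₂ q ; h₁ r = p
      set r := h₂ q with hr
      have hbr : b r = b q := hb q
      have h1r : h₁ r = p := by rw [hr, hq]; exact H p
      have har : a r = a p := by rw [← ha r, h1r]
      -- if a q > a p then r has smaller rank than p, hence is fixed by h₁, contradiction
      have haq' : a q = a p := by
        by_contra hne
        have hlt : a p < a q := lt_of_le_of_ne haq (Ne.symm hne)
        have hbq : b q < b p := by omega
        have hrk_r : rk r < rk p := rk_lt_of_b_lt r p har (by rw [hbr]; exact hbq)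
        have hfix := (ih (rk r) (hp ▸ hrk_r) r rfl).2.2
        have hrp : r = p := by rw [← hfix]; exact h1r
        rw [hrp] at hrk_r; exact lt_irrefl _ hrk_r
      have hbq : b q = b p := by omega
      have hqp : q = p := hinj q p haq' hbq
      have hrp : r = p := hinj r p har (by rw [hbr, hbq])
      refine ⟨hqp, ?_, ?_⟩
      · calc h₂ p = h₂ q := by rw [hqp]
          _ = r := hr.symm
          _ = p := hrp
      · rw [hrp] at h1r; exact h1r
  refine ⟨fun p => (main _ p rfl).2.2, fun p => (main _ p rfl).2.1, fun p => (main _ p rfl).1⟩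

/-! ### Coordinate-preserving subgroups and transport of the TPP -/

/-- The subgroup of permutations preserving a labelling `f` (a Young subgroup when `P = Fin n`). [folklore] -/
def coordSubgroup {P : Type*} (f : P → ℕ) : Subgroup (Perm P) where
  carrier := {σ | ∀ x, f (σ x) = f x}
  mul_mem' {σ τ} hσ hτ x := by
    show f (σ (τ x)) = f x
    rw [hσ (τ x), hτ x]
  one_mem' x := rfl
  inv_mem' {σ} hσ x := by
    show f (σ.symm x) = f x
    have h := hσ (σ.symm x)
    rw [Equiv.apply_symm_apply] at h
    exact h.symm

/-- Membership in a coordinate subgroup. [folklore] -/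
theorem mem_coordSubgroup {P : Type*} {f : P → ℕ} {σ : Perm P} :
    σ ∈ coordSubgroup f ↔ ∀ x, f (σ x) = f x := Iff.rfl

/-- The TPP of the three coordinate subgroups (as finsets), from the abstract triangle lemma. [cite: CohnUmans2003, §3 (triangle construction)] -/
theorem tpp_coordSubgroups {P : Type*} [Fintype P] [DecidableEq P] (a b c : P → ℕ)
    (hsum : ∀ p q, a p + b p + c p = a q + b q + c q)
    (hinj : ∀ p q, a p = a q → b p = b q → p = q)
    [DecidablePred (· ∈ coordSubgroup a)] [DecidablePred (· ∈ coordSubgroup b)]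
    [DecidablePred (· ∈ coordSubgroup c)] :
    Literature.Combinatorics.Additive.TripleProductProperty
      (Finset.univ.filter (· ∈ coordSubgroup a)) (Finset.univ.filter (· ∈ coordSubgroup b))
      (Finset.univ.filter (· ∈ coordSubgroup c)) := by
  intro s hs s' hs' t ht t' ht' u hu u' hu' he
  simp only [Finset.mem_filter, Finset.mem_univ, true_and] at hs hs' ht ht' hu hu'
  have h1 : s * s'⁻¹ ∈ coordSubgroup a := (coordSubgroup a).mul_mem hs ((coordSubgroup a).inv_mem hs')
  have h2 : t * t'⁻¹ ∈ coordSubgroup b := (coordSubgroup b).mul_mem ht ((coordSubgroup b).inv_mem ht')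
  have h3 : u * u'⁻¹ ∈ coordSubgroup c := (coordSubgroup c).mul_mem hu ((coordSubgroup c).inv_mem hu')
  have H : ∀ p, (s * s'⁻¹) ((t * t'⁻¹) ((u * u'⁻¹) p)) = p := by
    intro p
    have := Equiv.congr_fun he p
    simpa [Perm.mul_apply] using this
  obtain ⟨k1, k2, k3⟩ := triangle_trivial a b c hsum hinj (s * s'⁻¹) (t * t'⁻¹) (u * u'⁻¹) h1 h2 h3 H
  have e1 : s * s'⁻¹ = 1 := Equiv.ext k1
  have e2 : t * t'⁻¹ = 1 := Equiv.ext k2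
  have e3 : u * u'⁻¹ = 1 := Equiv.ext k3
  exact ⟨mul_inv_eq_one.1 e1, mul_inv_eq_one.1 e2, mul_inv_eq_one.1 e3⟩

/-- Precomposing the labelling with a permutation conjugates the coordinate subgroup. [folklore] -/
theorem coordSubgroup_comp {P : Type*} (f : P → ℕ) (e : Perm P) :
    coordSubgroup (f ∘ e) = (coordSubgroup f).map (MulAut.conj e⁻¹).toMonoidHom := by
  ext σ
  rw [Subgroup.mem_map_equiv, mem_coordSubgroup, mem_coordSubgroup]
  simp only [Function.comp_apply, MulAut.conj_symm_apply, inv_inv, Perm.mul_apply]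
  constructor
  · intro h x
    have := h (e⁻¹ x)
    simpa using this
  · intro h x
    have := h (e x)
    simpa using this

/-- Precomposition with a permutation does not change the order of a coordinate subgroup. [folklore] -/
theorem natCard_coordSubgroup_comp {P : Type*} [Fintype P] (f : P → ℕ) (e : Perm P) :
    Nat.card (coordSubgroup (f ∘ e)) = Nat.card (coordSubgroup f) := by
  rw [coordSubgroup_comp]
  exact Subgroup.card_map_of_injective (MulAut.conj e⁻¹).injective

/-- Transport of the TPP along an injective group hom. [cite: CohnUmans2003, §3 (triangle construction)] -/
theorem tpp_image {G H : Type*} [Group G] [Group H] [DecidableEq H] (φ : G →* H)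
    (hφ : Function.Injective φ) {S T U : Finset G}
    (h : Literature.Combinatorics.Additive.TripleProductProperty S T U) :
    Literature.Combinatorics.Additive.TripleProductProperty (S.image φ) (T.image φ) (U.image φ) := by
  intro s hs s' hs' t ht t' ht' u hu u' hu' he
  simp only [Finset.mem_image] at hs hs' ht ht' hu hu'
  obtain ⟨s0, hs0, rfl⟩ := hs; obtain ⟨s0', hs0', rfl⟩ := hs'
  obtain ⟨t0, ht0, rfl⟩ := ht; obtain ⟨t0', ht0', rfl⟩ := ht'
  obtain ⟨u0, hu0, rfl⟩ := hu; obtain ⟨u0', hu0', rfl⟩ := hu'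
  have he' : φ (s0 * s0'⁻¹ * (t0 * t0'⁻¹) * (u0 * u0'⁻¹)) = φ 1 := by
    simpa [map_mul, map_inv] using he
  obtain ⟨h1, h2, h3⟩ := h s0 hs0 s0' hs0' t0 ht0 t0' ht0' u0 hu0 u0' hu0' (hφ he')
  exact ⟨by rw [h1], by rw [h2], by rw [h3]⟩

/-! ### The triangle of side `N` -/

/-- Points `(i, j)` with `i + j < N`. [folklore] -/
abbrev Tri (N : ℕ) := Σ i : Fin N, Fin (N - i)

/-- First coordinate `a`. [folklore] -/
def ca {N : ℕ} (p : Tri N) : ℕ := p.1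
/-- Second coordinate `b`. [folklore] -/
def cb {N : ℕ} (p : Tri N) : ℕ := p.2
/-- Third coordinate `c = N - 1 - a - b`. [folklore] -/
def cc {N : ℕ} (p : Tri N) : ℕ := N - 1 - p.1 - p.2

/-- The three coordinates of the staircase have constant sum `N - 1`. [folklore] -/
theorem tri_sum {N : ℕ} (p q : Tri N) : ca p + cb p + cc p = ca q + cb q + cc q := by
  have hp1 := p.1.2; have hp2 := p.2.2; have hq1 := q.1.2; have hq2 := q.2.2
  simp only [ca, cb, cc]; omega

/-- A staircase point is determined by `(a, b)`. [folklore] -/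
theorem tri_inj {N : ℕ} (p q : Tri N) (h1 : ca p = ca q) (h2 : cb p = cb q) : p = q := by
  obtain ⟨i, j⟩ := p; obtain ⟨i', j'⟩ := q
  simp only [ca, cb] at h1 h2
  have hi : i = i' := Fin.ext h1
  subst hi
  have hj : j = j' := Fin.ext h2
  subst hj; rfl

/-- The swap `(i, j) ↦ (j, i)` of the triangle. [cite: CohnUmans2003, §3 (triangle construction)] -/
def swapAB {N : ℕ} (p : Tri N) : Tri N :=
  ⟨⟨p.2, by have := p.2.2; have := p.1.2; omega⟩, ⟨p.1, by have := p.2.2; have := p.1.2; simp; omega⟩⟩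

/-- The swap `(a, b, c) ↦ (c, b, a)` of the triangle. [cite: CohnUmans2003, §3 (triangle construction)] -/
def swapAC {N : ℕ} (p : Tri N) : Tri N :=
  ⟨⟨N - 1 - p.1 - p.2, by have := p.1.2; omega⟩, ⟨p.2, by have := p.2.2; have := p.1.2; simp; omega⟩⟩

/-- `swapAB` is an involution. [folklore] -/
theorem swapAB_invol {N : ℕ} : Function.Involutive (swapAB (N := N)) := by
  intro p; apply tri_inj <;> simp [swapAB, ca, cb]

/-- `swapAC` is an involution. [folklore] -/
theorem swapAC_invol {N : ℕ} : Function.Involutive (swapAC (N := N)) := by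
  intro p
  have := p.1.2; have := p.2.2
  apply tri_inj <;> simp [swapAC, ca, cb]; omega

/-- `b = a ∘ swapAB`. [folklore] -/
theorem cb_eq {N : ℕ} : (cb : Tri N → ℕ) = ca ∘ (swapAB_invol (N := N)).toPerm _ := by
  funext p; rfl

/-- `c = a ∘ swapAC`. [folklore] -/
theorem cc_eq {N : ℕ} : (cc : Tri N → ℕ) = ca ∘ (swapAC_invol (N := N)).toPerm _ := by
  funext p; rfl

/-- `|H_a| ≥ ∏_{i<N} (N - i)!` : the fibrewise permutations. [folklore] -/
theorem card_coordSubgroup_ca (N : ℕ) :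
    ∏ i : Fin N, (N - i).factorial ≤ Nat.card (coordSubgroup (ca : Tri N → ℕ)) := by
  classical
  let F : (Π i : Fin N, Perm (Fin (N - i))) → coordSubgroup (ca : Tri N → ℕ) :=
    fun g => ⟨Perm.sigmaCongrRightHom _ g, fun x => by simp [ca, Perm.sigmaCongrRightHom, Equiv.sigmaCongrRight]⟩
  have hF : Function.Injective F := by
    intro g g' h
    exact Perm.sigmaCongrRightHom_injective (congrArg Subtype.val h)
  have := Nat.card_le_card_of_injective F hF
  rw [Nat.card_eq_fintype_card, Fintype.card_pi] at this
  simp only [Fintype.card_perm, Fintype.card_fin] at this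
  exact this

/-- `|H_b| ≥ ∏_{i<N} (N - i)!`. [folklore] -/
theorem card_coordSubgroup_cb (N : ℕ) :
    ∏ i : Fin N, (N - i).factorial ≤ Nat.card (coordSubgroup (cb : Tri N → ℕ)) := by
  rw [cb_eq, natCard_coordSubgroup_comp]; exact card_coordSubgroup_ca N

/-- `|H_c| ≥ ∏_{i<N} (N - i)!`. [folklore] -/
theorem card_coordSubgroup_cc (N : ℕ) :
    ∏ i : Fin N, (N - i).factorial ≤ Nat.card (coordSubgroup (cc : Tri N → ℕ)) := by
  rw [cc_eq, natCard_coordSubgroup_comp]; exact card_coordSubgroup_ca N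

/-- `|Tri N| = N (N + 1) / 2`, in the form `2 |Tri N| = N (N + 1)`. [folklore] -/
theorem two_mul_card_tri (N : ℕ) : 2 * Fintype.card (Tri N) = N * (N + 1) := by
  rw [Fintype.card_sigma]
  simp only [Fintype.card_fin]
  rw [Fin.sum_univ_eq_sum_range (fun i => N - i) N]
  have h1 : ∑ i ∈ Finset.range N, (N - i) = ∑ i ∈ Finset.range N, (i + 1) := by
    rw [← Finset.sum_range_reflect (fun i => i + 1) N]
    refine Finset.sum_congr rfl fun i hi => ?_
    rw [Finset.mem_range] at hi; omega
  rw [h1, Finset.sum_add_distrib, Finset.sum_const, Finset.card_range, smul_eq_mul, mul_one, mul_add,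
    mul_comm 2 (∑ i ∈ Finset.range N, i), Finset.sum_range_id_mul_two]
  rcases N with _ | N
  · simp
  · simp; ring

/-- `Nat.card` of a subgroup is the card of its membership filter. [folklore] -/
theorem natCard_subgroup_eq_card_filter {G : Type*} [Group G] [Fintype G] (H : Subgroup G)
    [DecidablePred (· ∈ H)] : Nat.card H = (Finset.univ.filter (· ∈ H)).card := by
  rw [Nat.card_eq_fintype_card, ← Fintype.card_subtype]

/-- **The triangle TPP family in `S_n`** (Cohn–Umans 2003, Thm. 6): for every `N` there is a TPP triple of subsets of
`S_n`, `2n = N(N+1)`, each of size at least `∏_{k=1}^{N} k!`. [cite: CohnUmans2003, §3 (triangle construction)] -/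
theorem CohnUmans2003_triangle_tpp (N : ℕ) : ∃ n : ℕ, 2 * n = N * (N + 1) ∧
    ∃ S T U : Finset (Perm (Fin n)), Literature.Combinatorics.Additive.TripleProductProperty S T U ∧
      ∏ i : Fin N, (N - i).factorial ≤ S.card ∧ ∏ i : Fin N, (N - i).factorial ≤ T.card ∧
      ∏ i : Fin N, (N - i).factorial ≤ U.card := by
  classical
  refine ⟨Fintype.card (Tri N), two_mul_card_tri N, ?_⟩
  set e := Fintype.equivFin (Tri N)
  set φ : Perm (Tri N) →* Perm (Fin (Fintype.card (Tri N))) := (Equiv.permCongrHom e).toMonoidHom with hφ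
  have hφi : Function.Injective φ := (Equiv.permCongrHom e).injective
  have htpp := tpp_coordSubgroups (ca : Tri N → ℕ) cb cc tri_sum tri_inj
  refine ⟨_, _, _, tpp_image φ hφi htpp, ?_, ?_, ?_⟩
  · rw [Finset.card_image_of_injective _ hφi, ← natCard_subgroup_eq_card_filter]
    exact card_coordSubgroup_ca N
  · rw [Finset.card_image_of_injective _ hφi, ← natCard_subgroup_eq_card_filter]
    exact card_coordSubgroup_cb N
  · rw [Finset.card_image_of_injective _ hφi, ← natCard_subgroup_eq_card_filter]
    exact card_coordSubgroup_cc N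


end CohnUmansTriangle

end Literature.Computability.AlgebraicComplexity
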